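import Summits.CriticalPhenomena.CardyFormulaZ2.Theorems.CardyMagicRigidityNestingRigidityBigLoopsTightZ2
import Summits.CriticalPhenomena.CardyFormulaZ2.Theorems.CardyMagicRigidityNestingRigidityBigLoopsTightT
import Summits.CriticalPhenomena.CardyFormulaZ2.Theorems.CardyMagicRigidityNestingRigidityTowerCountMeasurable
import Summits.CriticalPhenomena.CardyFormulaZ2.Theorems.CardyMagicRigidityNestingRigidityFirstMomentIdentity
import Literature.Probability.RandomPlanarGeometry.CurveTightness
import HarnessLib

/-!
# First moment of the number of big interface loops in a window, both lattices, all scales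

Crux `Summit.CriticalPhenomena.CardyFormulaZ2.Theses.CardyMagicRigidity.NestingRigidity`
(stmt-CriticalPhenomena-4835), line `ring-cloud-tomography`, registered keystone stub K1
`integral_ncard_bigLoops_le`: for `E ∈ latticeEnsembles` there are `C, c₀ > 0` with
`E_δ[#{u ∈ X_δ : trace u ⊆ B(0, R), diam (trace u) ≥ η}] ≤ C (R/η)²` for ALL `0 < δ`,
`c₀ δ ≤ η ≤ R` (integrability included) — the uniform first-moment input of the RSW layer of the
line (summed over dyadic scales down to the mesh in hypotheses (L)/(U)/(QU)).

* §1 both lattices: loop counts cut out by a predicate are measurable, and finite, bounded and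
  integrable once the predicate forces the trace into a fixed ball (fixed mesh);
* §2 bond-`ℤ²` (`c₀ = 12`, `C = 800 C_top`): Nolin's counting argument — big loops are at most local
  tops (`encard_bigLoops_le_encard_tops`, `integral_topCount_le` of the tightness file);
* §3 site-`𝕋` (`c₀ = 32000`): cover `B̄(0, R)` by `O((R/η)²)` discs of radius `η/32`; `2j + 2` big
  loops through one disc give `j` disjoint open arms across a fixed-aspect annulus
  (Aizenman–Burchard), an event of probability `≤ 3^{-α j}` (BK + RSW), so the expected number of
  big loops through one disc is `O(1)`;
* §4 the registered statement, by cases on `latticeEnsembles = {zEns, tEns}`.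
-/

noncomputable section

open MeasureTheory Set Filter Metric
open scoped Real Topology BigOperators ENNReal

namespace Summit.CriticalPhenomena.CardyFormulaZ2.Cruxes.NestingRigidity.RingCloudTomography

open Literature.Probability.RandomPlanarGeometry Literature.Probability.Percolation
  Literature.Probability.LatticeModels
open Summit.CriticalPhenomena.CardyFormulaZ2.Cruxes.NestingRigidity.MarkovCascadeOneGeneration
  (encard_bigLoops_le_encard_tops integral_topCount_le topCount_eq_card
    exists_walk_of_mem_loops_siteLoopConfig range_mk_siteLoopCurve_eq_polyTrace
    polyTrace_ne_of_unbasedLoop_ne)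

namespace BigLoops

/-! ## §1 Loop counts on both lattices: measurability, finiteness, integrability -/

/-- On both lattice ensembles the number of loops cut out by a deterministic predicate is a
measurable (integer-valued) random variable. -/
theorem measurable_ncard_loops_sep : ∀ E ∈ latticeEnsembles, ∀ (δ : ℝ)
    (Q : UnbasedLoop ℂ → Prop), Measurable fun ω ↦ {u ∈ (E.X δ ω).loops | Q u}.ncard := by
  intro E hE δ Q
  haveI := countable_sigma_hexLoop
  simp only [latticeEnsembles, Set.mem_insert_iff, Set.mem_singleton_iff] at hE
  rcases hE with rfl | rfl
  · simp_rw [loops_zEns_eq_image]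
    exact measurable_ncard_image_sep _ measurable_mem_bondIndex _
  · simp_rw [loops_tEns_eq_image]
    exact measurable_ncard_image_sep _ measurable_mem_siteIndex _

/-- On both lattice ensembles, at a fixed mesh `δ > 0`, the loops with trace inside `B(0, R)` cut
out by any further predicate form a finite set whose cardinality is bounded by a deterministic
constant depending on `δ` and `R` only. -/
theorem exists_ncard_loops_sep_le : ∀ E ∈ latticeEnsembles, ∀ {δ : ℝ}, 0 < δ → ∀ R : ℝ,
    ∃ N : ℕ, ∀ (Q : UnbasedLoop ℂ → Prop), (∀ u, Q u → u.range ⊆ ball (0 : ℂ) R) →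
      ∀ ω : E.Ω, {u ∈ (E.X δ ω).loops | Q u}.Finite ∧ {u ∈ (E.X δ ω).loops | Q u}.ncard ≤ N := by
  intro E hE δ hδ R
  obtain ⟨N, hN⟩ := FirstMoment.exists_ncard_loops_meeting_le E hE hδ R
  refine ⟨N, fun Q hQ ω ↦ ?_⟩
  obtain ⟨hfin, hle⟩ := hN ω
  have hsub : {u ∈ (E.X δ ω).loops | Q u} ⊆
      {u ∈ (E.X δ ω).loops | (u.range ∩ closedBall (0 : ℂ) R).Nonempty} := by
    rintro u ⟨hu, hq⟩
    obtain ⟨z, hz⟩ := u.range_nonempty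
    exact ⟨hu, z, hz, ball_subset_closedBall (hQ u hq hz)⟩
  exact ⟨hfin.subset hsub, (ncard_le_ncard hsub hfin).trans hle⟩

/-- On both lattice ensembles, at a fixed mesh `δ > 0`, the number of loops with trace inside
`B(0, R)` cut out by any further predicate is an integrable real random variable. -/
theorem integrable_ncard_loops_sep : ∀ E ∈ latticeEnsembles, ∀ {δ : ℝ}, 0 < δ → ∀ (R : ℝ)
    (Q : UnbasedLoop ℂ → Prop), (∀ u, Q u → u.range ⊆ ball (0 : ℂ) R) →
      Integrable (fun ω ↦ ({u ∈ (E.X δ ω).loops | Q u}.ncard : ℝ)) E.P := by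
  intro E hE δ hδ R Q hQ
  haveI := isProbabilityMeasure_of_mem hE
  obtain ⟨N, hN⟩ := exists_ncard_loops_sep_le E hE hδ R
  refine Integrable.of_bound
    (measurable_from_nat.comp (measurable_ncard_loops_sep E hE δ Q)).aestronglyMeasurable N
    (Eventually.of_forall fun ω ↦ ?_)
  rw [Real.norm_eq_abs, Nat.abs_cast]
  exact_mod_cast (hN Q hQ ω).2

/-! ## §2 Bond-`ℤ²`: big loops are counted by local tops (Nolin's counting argument) -/

/-- **First moment of the number of big loops on bond-`ℤ²`, all scales above the mesh.** There are
`C, c₀ > 0` such that for `0 < δ`, `c₀ δ ≤ η ≤ R` the number of loops of `X_δ = bondLoopConfig δ 0`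
with trace in `B(0, R)` and diameter `≥ η` is integrable with mean `≤ C (R/η)²`: on lattice
configurations every such loop passes through the top corner of a local top at scale
`s = ⌊(η/δ - 2)/4⌋ ≥ η/(8δ)` of `ω` in `B(⌈R/δ⌉)` or of `dualConfig ω` in `B(⌈R/δ⌉ + 1)`
(`encard_bigLoops_le_encard_tops`), and the expected number of local tops is
`≤ (|B(⌈R/δ⌉)| + |B(⌈R/δ⌉ + 1)|) C/s² ≤ 800 C (R/η)²` (`integral_topCount_le`,
`real_localTopEvent_le_of_one_le`), for `12 δ ≤ η ≤ R`. -/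
theorem integral_ncard_bigLoops_le_zEns : ∃ C c₀ : ℝ, 0 < C ∧ 0 < c₀ ∧ ∀ (R η δ : ℝ), 0 < δ →
    c₀ * δ ≤ η → η ≤ R →
      Integrable (fun ω ↦ ({u ∈ (zEns.X δ ω).loops |
        u.range ⊆ Metric.ball (0 : ℂ) R ∧ η ≤ Metric.diam u.range}.ncard : ℝ)) zEns.P ∧
      ∫ ω, ({u ∈ (zEns.X δ ω).loops |
        u.range ⊆ Metric.ball (0 : ℂ) R ∧ η ≤ Metric.diam u.range}.ncard : ℝ) ∂zEns.P ≤
          C * (R / η) ^ 2 := by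
  obtain ⟨C, hC, hloc⟩ := real_localTopEvent_le_of_one_le
  refine ⟨800 * C, 12, by positivity, by norm_num, fun R η δ hδ hηδ hηR ↦ ?_⟩
  have hη : 0 < η := lt_of_lt_of_le (by positivity) hηδ
  have hR : 0 < R := hη.trans_le hηR
  -- the scale
  set D : ℝ := η / δ with hD
  have hD12 : 12 ≤ D := by rwa [hD, le_div_iff₀ hδ]
  obtain ⟨s, hs1, hsD, hsD'⟩ : ∃ s : ℕ, 1 ≤ s ∧ (4 * s + 2 : ℝ) ≤ η / δ ∧ D / 8 ≤ s := by
    refine ⟨⌊(D - 2) / 4⌋₊, Nat.le_floor (by push_cast; linarith), ?_, ?_⟩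
    · have := Nat.floor_le (show 0 ≤ (D - 2) / 4 by linarith); rw [← hD]; linarith
    · have := Nat.lt_floor_add_one ((D - 2) / 4); linarith
  -- the counting function
  set L₁ : ℕ := ⌈R / δ⌉₊ with hL₁
  set f : BondConfig (Site 2) → ℝ := fun ω ↦
    ∑ x ∈ box 2 L₁, (localTopEvent ![0, 1] x s).indicator (fun _ ↦ (1 : ℝ)) ω +
      ∑ g ∈ box 2 (L₁ + 1), (dualConfig ⁻¹' localTopEvent ![0, 1] g s).indicator
        (fun _ ↦ (1 : ℝ)) ω with hf
  obtain ⟨hint, hle⟩ := integral_topCount_le hloc ![0, 1] L₁ (L₁ + 1) hs1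
  -- integrability of the loop count
  have hintS := integrable_ncard_loops_sep zEns zEns_mem hδ R
    (fun u ↦ u.range ⊆ Metric.ball (0 : ℂ) R ∧ η ≤ Metric.diam u.range) fun u h ↦ h.1
  refine ⟨hintS, ?_⟩
  -- Step 1: pointwise (a.e.) the loop count is at most the number of local tops
  have hstep1 : ∀ᵐ ω ∂zEns.P, ({u ∈ (zEns.X δ ω).loops |
      u.range ⊆ Metric.ball (0 : ℂ) R ∧ η ≤ Metric.diam u.range}.ncard : ℝ) ≤ f ω := by
    change ∀ᵐ ω ∂(bondPercolation (zdGraph 2) half),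
      (({u ∈ (bondLoopConfig δ 0 ω).loops |
        u.range ⊆ Metric.ball (0 : ℂ) R ∧ η ≤ Metric.diam u.range}.ncard : ℕ) : ℝ) ≤ f ω
    filter_upwards [ae_subset_edgeSet (zdGraph 2) half] with ω hω
    have hT₁ : {x : Site 2 | x ∈ box 2 ⌈R / δ⌉₊ ∧ IsLocalTop ![0, 1] ω x s}.encard ≠ ⊤ :=
      encard_ne_top_iff.2 ((box 2 ⌈R / δ⌉₊).finite_toSet.subset fun x hx ↦ hx.1)
    have hT₂ : {g : Site 2 | g ∈ box 2 (⌈R / δ⌉₊ + 1) ∧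
        IsLocalTop ![0, 1] (dualConfig ω) g s}.encard ≠ ⊤ :=
      encard_ne_top_iff.2 ((box 2 (⌈R / δ⌉₊ + 1)).finite_toSet.subset fun x hx ↦ hx.1)
    have hle₃ := ENat.toNat_le_toNat (encard_bigLoops_le_encard_tops (R := R) hδ hs1 hsD hω)
      (WithTop.add_ne_top.2 ⟨hT₁, hT₂⟩)
    rw [ENat.toNat_add hT₁ hT₂, ← Set.ncard_def] at hle₃
    rw [hf]
    dsimp only
    rw [topCount_eq_card]
    exact_mod_cast hle₃
  -- Step 2: integrate
  refine (integral_mono_ae hintS hint hstep1).trans (hle.trans ?_)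
  -- Step 3: arithmetic, uniformly in `δ`
  have hX : 12 ≤ R / δ := hD12.trans (div_le_div_of_nonneg_right hηR hδ.le)
  have h2 : (⌈R / δ⌉₊ : ℝ) < R / δ + 1 := Nat.ceil_lt_add_one (by positivity)
  have h0 : (0 : ℝ) ≤ ⌈R / δ⌉₊ := Nat.cast_nonneg _
  have hcards : ((box 2 L₁).card : ℝ) + (box 2 (L₁ + 1)).card ≤ 25 / 2 * (R / δ) ^ 2 := by
    rw [card_box, card_box, hL₁]
    push_cast
    nlinarith [mul_nonneg h0 (sub_nonneg.2 h2.le), mul_self_nonneg (R / δ - 12)]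
  have hsC : C / (s : ℝ) ^ 2 ≤ 64 * C / D ^ 2 := by
    calc C / (s : ℝ) ^ 2 ≤ C / (D / 8) ^ 2 :=
          div_le_div_of_nonneg_left hC.le (by positivity) (pow_le_pow_left₀ (by positivity) hsD' 2)
      _ = 64 * C / D ^ 2 := by field_simp; ring
  calc (((box 2 L₁).card : ℝ) + (box 2 (L₁ + 1)).card) * (C / (s : ℝ) ^ 2)
      ≤ (25 / 2 * (R / δ) ^ 2) * (64 * C / D ^ 2) :=
        mul_le_mul hcards hsC (by positivity) (by positivity)
    _ = 800 * C * (R / η) ^ 2 := by rw [hD]; field_simp; ring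

/-! ## §3 Site-`𝕋`: big loops near a point are counted by disjoint arm events (BK + RSW) -/

/-- **Elementary counting**: an integer `n ≤ N` is at most `1 + 2 · #{j < N : 2j + 2 ≤ n}`; in the
weighted form used below, `n ≤ 1 + 2 Σ_{j < N} a_j` whenever `a ≥ 0` and `a_j ≥ 1` for
`2j + 2 ≤ n`. -/
theorem nat_le_one_add_two_mul_sum {n N : ℕ} (hn : n ≤ N) (a : ℕ → ℝ) (ha0 : ∀ j, 0 ≤ a j)
    (ha : ∀ j, 2 * j + 2 ≤ n → 1 ≤ a j) :
    (n : ℝ) ≤ 1 + 2 * ∑ j ∈ Finset.range N, a j := by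
  have hsub : Finset.range (n / 2) ⊆ Finset.range N := by
    refine Finset.range_subset_range.2 ?_
    omega
  have h1 : ((n / 2 : ℕ) : ℝ) ≤ ∑ j ∈ Finset.range N, a j := by
    calc ((n / 2 : ℕ) : ℝ) = ∑ _j ∈ Finset.range (n / 2), (1 : ℝ) := by
          rw [Finset.sum_const, Finset.card_range, nsmul_eq_mul, mul_one]
      _ ≤ ∑ j ∈ Finset.range (n / 2), a j :=
          Finset.sum_le_sum fun j hj ↦ ha j (by rw [Finset.mem_range] at hj; omega)
      _ ≤ ∑ j ∈ Finset.range N, a j :=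
          Finset.sum_le_sum_of_subset_of_nonneg hsub fun j _ _ ↦ ha0 j
  have h2 : (n : ℝ) ≤ 1 + 2 * ((n / 2 : ℕ) : ℝ) := by
    have : n ≤ 1 + 2 * (n / 2) := by omega
    exact_mod_cast this
  linarith

/-- **Covering a disc by small discs at scale**: for `0 < r ≤ R` the closed disc `B̄(0, R)` is
covered by the closed `r`-discs about at most `81 (R/r)²` points `r y` (the grid cover
`exists_finset_card_le_cover_closedBall` of `B̄(0, R/r)` by unit discs, rescaled by `r`). -/
theorem exists_cover_closedBall {r R : ℝ} (hr : 0 < r) (hrR : r ≤ R) :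
    ∃ S : Finset ℂ, (S.card : ℝ) ≤ 81 * (R / r) ^ 2 ∧
      closedBall (0 : ℂ) R ⊆ ⋃ y ∈ S, closedBall ((r : ℂ) * y) r := by
  have hRr : 1 ≤ R / r := by rwa [le_div_iff₀ hr, one_mul]
  obtain ⟨S, hcard, hcov⟩ :=
    exists_finset_card_le_cover_closedBall (r₀ := R / r) (by positivity) 1 one_pos le_rfl
  refine ⟨S, ?_, fun z hz ↦ ?_⟩
  · rw [Real.one_rpow, mul_one] at hcard
    nlinarith
  · have hz' : z / r ∈ closedBall (0 : ℂ) (R / r) := by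
      rw [mem_closedBall, dist_zero_right] at hz ⊢
      rw [norm_div, Complex.norm_real, Real.norm_of_nonneg hr.le]
      exact div_le_div_of_nonneg_right hz hr.le
    obtain ⟨y, hy, hzy⟩ := mem_iUnion₂.1 (hcov hz')
    refine mem_iUnion₂.2 ⟨y, hy, ?_⟩
    rw [mem_closedBall, dist_eq_norm] at hzy ⊢
    have hrne : (r : ℂ) ≠ 0 := by exact_mod_cast hr.ne'
    have : z - (r : ℂ) * y = (r : ℂ) * (z / r - y) := by
      field_simp
    rw [this, norm_mul, Complex.norm_real, Real.norm_of_nonneg hr.le]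
    nlinarith

/-- **Many big loops through one small disc force disjoint open arms** (Aizenman–Burchard 1999,
App. A, in the tree as `mem_disjointOccurrencePow_of_distinct_loops`): if a finite family `A` of at
least `2j + 2` loops of `siteLoopConfig δ ω`, each of diameter `≥ η` and meeting `B̄(x, η/32)`, is
given and `0 < δ ≤ 3η/1280`, then `ω` has `j` disjoint open arms across `A(x; η/32 + 9δ, η/8 - 9δ)`
(represent the loops by interface loops of `ω`; distinct loops have distinct traces,
`polyTrace_ne_of_unbasedLoop_ne`). -/
theorem mem_disjointOccurrencePow_of_le_ncard {η δ : ℝ} (hη : 0 < η) (hδ : 0 < δ)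
    (hδη : δ ≤ 3 * (η / 2) / 640) {x : ℂ} {j : ℕ} {ω : SiteConfig (Site 2)}
    {A : Set (UnbasedLoop ℂ)} (hA : A.Finite)
    (hAS : ∀ u ∈ A, u ∈ (siteLoopConfig δ ω).loops ∧ η ≤ diam u.range ∧
      (u.range ∩ closedBall x (η / 2 / 16)).Nonempty)
    (hcard : 2 * j + 2 ≤ A.ncard) :
    ω ∈ disjointOccurrencePow (triArm δ x (η / 2 / 16 + 9 * δ) (η / 2 / 4 - 9 * δ)) j := by
  classical
  -- `2j + 2` distinct loops of `A`
  obtain ⟨t, htA, htcard⟩ := Finset.exists_subset_card_eq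
    (show 2 * j + 2 ≤ hA.toFinset.card by rwa [← Set.ncard_eq_toFinset_card A hA])
  set e := (t.equivFinOfCardEq htcard).symm with he
  have huA : ∀ l, (e l : UnbasedLoop ℂ) ∈ A := fun l ↦ hA.mem_toFinset.1 (htA (e l).2)
  -- interface loops representing them
  have hrep : ∀ l, ∃ (F : HexVertex) (γ : hexGraph.Walk F F), IsSiteInterfaceLoop ω γ ∧
      UnbasedLoop.mk (BasedLoop.mk (siteLoopCurve δ γ) (isLoop_siteLoopCurve δ γ)) = e l :=
    fun l ↦ exists_walk_of_mem_loops_siteLoopConfig (hAS _ (huA l)).1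
  choose F γ hγ hγu using hrep
  have hrange : ∀ l, (e l : UnbasedLoop ℂ).range = polyTrace δ (γ l) := fun l ↦ by
    rw [← hγu l]
    exact range_mk_siteLoopCurve_eq_polyTrace (hγ l)
  refine mem_disjointOccurrencePow_of_distinct_loops hδ (half_pos hη) hδη (f := F) (w := γ) hγ
    (fun l l' hll' ↦ ?_) (fun l ↦ ?_) (fun l ↦ ?_)
  · -- distinct loops have distinct traces
    refine polyTrace_ne_of_unbasedLoop_ne hδ.ne' (hγ _) (hγ _) ?_
    rw [hγu, hγu]
    exact fun h ↦ hll' (e.injective (Subtype.ext h))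
  · -- diameter `> η / 2`
    have h := (hAS _ (huA l)).2.1
    rw [hrange] at h
    linarith
  · -- the trace meets `B̄(x, η/32)`
    obtain ⟨z, hz, hzx⟩ := (hAS _ (huA l)).2.2
    rw [hrange] at hz
    exact ⟨z, hz, mem_closedBall.1 hzx⟩

/-- **First moment of the number of big loops on site-`𝕋`, all scales above the mesh.** There are
`C, c₀ > 0` such that for `0 < δ`, `c₀ δ ≤ η ≤ R` the number of loops of `X_δ = siteLoopConfig δ`
with trace in `B(0, R)` and diameter `≥ η` is integrable with mean `≤ C (R/η)²`: cover `B̄(0, R)`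
by `≤ 81 · 32² (R/η)²` discs `B̄(x, η/32)` (`exists_cover_closedBall`); every big loop meets one of
them, and the number `n_x` of big loops meeting `B̄(x, η/32)` satisfies
`{n_x ≥ 2j + 2} ⊆ (triArm δ x (η/32 + 9δ) (η/8 - 9δ))^{□ j}`
(`mem_disjointOccurrencePow_of_le_ncard`), an event of probability `≤ 3^{-α j}`
(`real_disjointOccurrencePow_triArm_le`: BK + RSW), so `E[n_x] ≤ 1 + 2 Σ_j 3^{-α j}`
(`nat_le_one_add_two_mul_sum`) and `E[#big loops] ≤ Σ_x E[n_x]`. -/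
theorem integral_ncard_bigLoops_le_tEns : ∃ C c₀ : ℝ, 0 < C ∧ 0 < c₀ ∧ ∀ (R η δ : ℝ), 0 < δ →
    c₀ * δ ≤ η → η ≤ R →
      Integrable (fun ω ↦ ({u ∈ (tEns.X δ ω).loops |
        u.range ⊆ Metric.ball (0 : ℂ) R ∧ η ≤ Metric.diam u.range}.ncard : ℝ)) tEns.P ∧
      ∫ ω, ({u ∈ (tEns.X δ ω).loops |
        u.range ⊆ Metric.ball (0 : ℂ) R ∧ η ≤ Metric.diam u.range}.ncard : ℝ) ∂tEns.P ≤
          C * (R / η) ^ 2 := by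
  classical
  obtain ⟨α, hα, hb⟩ := tri_annulusCrossing_bound_holds
  set θ : ℝ := (1 / 3 : ℝ) ^ α with hθ
  have hθ0 : 0 ≤ θ := by positivity
  have hθ1 : θ < 1 := Real.rpow_lt_one (by norm_num) (by norm_num) hα
  have h1θ : 0 < 1 - θ := sub_pos.2 hθ1
  set K : ℝ := 1 + 2 / (1 - θ) with hK
  have hK0 : 0 < K := by positivity
  refine ⟨81 * 32 ^ 2 * K, 32000, by positivity, by norm_num, fun R η δ hδ hηδ hηR ↦ ?_⟩
  have hη : 0 < η := lt_of_lt_of_le (by positivity) hηδ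
  set r : ℝ := η / 2 / 16 with hr
  have hr0 : 0 < r := by positivity
  have hrR : r ≤ R := by rw [hr]; linarith
  obtain ⟨S, hScard, hcover⟩ := exists_cover_closedBall hr0 hrR
  -- the predicates: big loops, and big loops meeting the disc about `r y`
  set big : UnbasedLoop ℂ → Prop := fun u ↦
    u.range ⊆ Metric.ball (0 : ℂ) R ∧ η ≤ Metric.diam u.range with hbig
  set Q : ℂ → UnbasedLoop ℂ → Prop := fun y u ↦
    big u ∧ (u.range ∩ closedBall ((r : ℂ) * y) r).Nonempty with hQ
  have hQbig : ∀ y u, Q y u → u.range ⊆ ball (0 : ℂ) R := fun y u h ↦ h.1.1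
  -- integrability and the deterministic bound on the counts
  have hintS := integrable_ncard_loops_sep tEns tEns_mem hδ R big fun u h ↦ h.1
  refine ⟨hintS, ?_⟩
  obtain ⟨N, hN⟩ := exists_ncard_loops_sep_le tEns tEns_mem hδ R
  -- the per-centre counts and their level sets
  set g : ℂ → SiteConfig (Site 2) → ℕ := fun y ω ↦
    {u ∈ (siteLoopConfig δ ω).loops | Q y u}.ncard with hg
  have hgm : ∀ y, Measurable (g y) := fun y ↦ measurable_ncard_loops_sep tEns tEns_mem δ (Q y)
  have hgN : ∀ y ω, g y ω ≤ N := fun y ω ↦ (hN (Q y) (hQbig y) ω).2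
  set Ev : ℂ → ℕ → Set (SiteConfig (Site 2)) := fun y j ↦ {ω | 2 * j + 2 ≤ g y ω} with hEv
  have hEvm : ∀ y j, MeasurableSet (Ev y j) := fun y j ↦
    hgm y (MeasurableSet.of_discrete (s := {m : ℕ | 2 * j + 2 ≤ m}))
  -- the level sets are disjoint-arm events, hence geometrically rare
  have hEv_sub : ∀ y j, Ev y j ⊆ disjointOccurrencePow
      (triArm δ ((r : ℂ) * y) (η / 2 / 16 + 9 * δ) (η / 2 / 4 - 9 * δ)) j := by
    intro y j ω hω
    exact mem_disjointOccurrencePow_of_le_ncard hη hδ (by linarith) (hN (Q y) (hQbig y) ω).1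
      (fun u hu ↦ ⟨hu.1, hu.2.1.2, hu.2.2⟩) hω
  have hEv_le : ∀ y j, (triSitePercolation half).real (Ev y j) ≤ θ ^ j := fun y j ↦
    (measureReal_mono (hEv_sub y j)).trans
      (real_disjointOccurrencePow_triArm_le hα hb hδ (half_pos hη) (by linarith) _ j)
  -- the dominating function
  set F : SiteConfig (Site 2) → ℝ := fun ω ↦
    ∑ y ∈ S, (1 + 2 * ∑ j ∈ Finset.range N, (Ev y j).indicator (fun _ ↦ (1 : ℝ)) ω) with hF
  have hsummand : ∀ y, Integrable (fun ω ↦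
      1 + 2 * ∑ j ∈ Finset.range N, (Ev y j).indicator (fun _ ↦ (1 : ℝ)) ω)
      (triSitePercolation half) := fun y ↦
    (integrable_const _).add
      ((integrable_finsetSum _ fun j _ ↦ (integrable_const _).indicator (hEvm y j)).const_mul _)
  have hFint : Integrable F (triSitePercolation half) := integrable_finsetSum _ fun y _ ↦ hsummand y
  have hdom : ∀ ω, (({u ∈ (siteLoopConfig δ ω).loops | big u}.ncard : ℕ) : ℝ) ≤ F ω := by
    intro ω
    -- every big loop meets one of the covering discs
    have hsub : {u ∈ (siteLoopConfig δ ω).loops | big u} ⊆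
        ⋃ y ∈ S, {u ∈ (siteLoopConfig δ ω).loops | Q y u} := by
      rintro u ⟨hu, hbu⟩
      obtain ⟨z, hz⟩ := u.range_nonempty
      have hzR : z ∈ closedBall (0 : ℂ) R := ball_subset_closedBall (hbu.1 hz)
      obtain ⟨y, hy, hzy⟩ := mem_iUnion₂.1 (hcover hzR)
      exact mem_iUnion₂.2 ⟨y, hy, hu, hbu, z, hz, hzy⟩
    have hUfin : (⋃ y ∈ S, {u ∈ (siteLoopConfig δ ω).loops | Q y u}).Finite :=
      (hN big (fun u h ↦ h.1) ω).1.subset (iUnion₂_subset fun y _ u hu ↦ ⟨hu.1, hu.2.1⟩)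
    have h1 : {u ∈ (siteLoopConfig δ ω).loops | big u}.ncard ≤ ∑ y ∈ S, g y ω :=
      (ncard_le_ncard hsub hUfin).trans (Finset.set_ncard_biUnion_le _ _)
    have h2 : ∀ y ∈ S, ((g y ω : ℕ) : ℝ) ≤
        1 + 2 * ∑ j ∈ Finset.range N, (Ev y j).indicator (fun _ ↦ (1 : ℝ)) ω := fun y _ ↦
      nat_le_one_add_two_mul_sum (hgN y ω) _
        (fun j ↦ Set.indicator_nonneg (fun _ _ ↦ zero_le_one) _)
        (fun j hj ↦ by rw [Set.indicator_of_mem (show ω ∈ Ev y j from hj)])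
    calc (({u ∈ (siteLoopConfig δ ω).loops | big u}.ncard : ℕ) : ℝ)
        ≤ ((∑ y ∈ S, g y ω : ℕ) : ℝ) := by exact_mod_cast h1
      _ = ∑ y ∈ S, ((g y ω : ℕ) : ℝ) := by push_cast; rfl
      _ ≤ F ω := Finset.sum_le_sum h2
  -- the integral of the dominating function
  have hFI : ∫ ω, F ω ∂(triSitePercolation half) =
      ∑ y ∈ S, (1 + 2 * ∑ j ∈ Finset.range N, (triSitePercolation half).real (Ev y j)) := by
    rw [integral_finsetSum _ fun y _ ↦ hsummand y]
    refine Finset.sum_congr rfl fun y _ ↦ ?_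
    rw [integral_add (integrable_const _)
        ((integrable_finsetSum _ fun j _ ↦ (integrable_const _).indicator (hEvm y j)).const_mul _),
      integral_const, integral_const_mul,
      integral_finsetSum _ fun j _ ↦ (integrable_const _).indicator (hEvm y j)]
    simp only [integral_indicator_const _ (hEvm _ _), smul_eq_mul, mul_one, probReal_univ]
  -- conclusion
  calc ∫ ω, (({u ∈ (siteLoopConfig δ ω).loops | big u}.ncard : ℕ) : ℝ) ∂(triSitePercolation half)
      ≤ ∫ ω, F ω ∂(triSitePercolation half) := integral_mono_ae hintS hFint (ae_of_all _ hdom)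
    _ = ∑ y ∈ S, (1 + 2 * ∑ j ∈ Finset.range N, (triSitePercolation half).real (Ev y j)) := hFI
    _ ≤ ∑ _y ∈ S, K := by
        refine Finset.sum_le_sum fun y _ ↦ ?_
        have hgeom := geom_sum_Ico_le_of_lt_one (m := 0) (n := N) hθ0 hθ1
        rw [pow_zero, ← Finset.range_eq_Ico] at hgeom
        have hsum := (Finset.sum_le_sum fun j _ ↦ hEv_le y j).trans hgeom
        rw [hK, div_eq_mul_one_div 2 (1 - θ)]
        linarith
    _ = S.card * K := by rw [Finset.sum_const, nsmul_eq_mul]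
    _ ≤ 81 * (R / r) ^ 2 * K := by gcongr
    _ = 81 * 32 ^ 2 * K * (R / η) ^ 2 := by rw [hr]; field_simp; ring

end BigLoops

/-! ## §4 Both lattice ensembles (registered keystone stub K1) -/

/-- **K1: first moment of the number of big loops in a window, both lattices, all scales above the
mesh.** For `E ∈ latticeEnsembles` there are `C, c₀ > 0` such that for every mesh `δ > 0`, scale
`η ≥ c₀ δ` and window radius `R ≥ η`, the number of loops of `X_δ` with trace in `B(0, R)` and
diameter `≥ η` is an integrable random variable with `E_δ[#] ≤ C (R/η)²` — uniformly down to the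
mesh, as needed when the bound is summed over dyadic scales (hypotheses (L), (U) of
`uvDecoupling_of_tilted_moments`, (QU) of `staircaseDecoupling_of_inputs`). On bond-`ℤ²` by Nolin's
local-top count (`BigLoops.integral_ncard_bigLoops_le_zEns`), on site-`𝕋` by the BK/RSW count of
loops through a small disc (`BigLoops.integral_ncard_bigLoops_le_tEns`). -/
theorem integral_ncard_bigLoops_le : ∀ E ∈ latticeEnsembles, ∃ C c₀ : ℝ, 0 < C ∧ 0 < c₀ ∧ ∀ (R η δ : ℝ), 0 < δ → c₀ * δ ≤ η → η ≤ R → Integrable (fun ω ↦ ({u ∈ (E.X δ ω).loops | u.range ⊆ Metric.ball (0 : ℂ) R ∧ η ≤ Metric.diam u.range}.ncard : ℝ)) E.P ∧ ∫ ω, ({u ∈ (E.X δ ω).loops | u.range ⊆ Metric.ball (0 : ℂ) R ∧ η ≤ Metric.diam u.range}.ncard : ℝ) ∂E.P ≤ C * (R / η) ^ 2 := by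
  intro E hE
  simp only [latticeEnsembles, Set.mem_insert_iff, Set.mem_singleton_iff] at hE
  rcases hE with rfl | rfl
  · exact BigLoops.integral_ncard_bigLoops_le_zEns
  · exact BigLoops.integral_ncard_bigLoops_le_tEns

end Summit.CriticalPhenomena.CardyFormulaZ2.Cruxes.NestingRigidity.RingCloudTomography

end
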